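import Literature.MathematicalPhysics.KineticTheory.HardSphereEulerProofs

/-!
# The entropy clock `ClampedWindowDock` (stmt-AtomisticToContinuum-13735), VI: the entropy production is a one-body functional

Step (i) of the dock's informal proof, continued from the tree's transport/production identities
(`OneFlightGossipEngineAssemblyEntropyTransport/Production`, sibling dock 14647/14680):
`KL(lawAt Φ λ_N t ‖ ψ) − KL(λ_N ‖ ψ₀) = E_{λ_N}[log ρ_{ψ₀} − log ρ_ψ ∘ Φ_t]`. Here the log-densities of the
local Gibbs references are made EXPLICIT, so that the right-hand side becomes the expectation of a ONE-BODY
functional of the trajectory endpoints plus a c-number: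

* `log_localGibbsProfile` — `log (a(x) M_{1,u(x),θ(x)}(v)) = g(x,v) := log a(x) − (3/2) log(2πθ(x)) − |v − u(x)|²/(2θ(x))`
  (the ONE-BODY EXPONENT, written out in every statement — no abbreviation is introduced);
* `log_canonicalDensity_localGibbsProfile` — on the hard-sphere domain,
  `log ρ_ψ(z) = −log Z_pos(a) + Σ_i g(z_i)` with the one-body exponent `g` above (`Z_pos` the configurational
  partition function `posPartition`);
* `ae_logRatio_eq_oneBody` — `λ_N`-almost surely (the law lives on the hard-sphere domain, which the flow
  preserves on its good set), for two local Gibbs references `ψ₀ = (b₀, w₀, ϑ₀)`, `ψ = (b, w, ϑ)`: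
  `log ρ_{ψ₀}(z) − log ρ_ψ(Φ_t z) = [Σ_i g₀(z_i) − Σ_i g((Φ_t z)_i)] + log Z_pos(b) − log Z_pos(b₀)` — so the
  right-hand side of the tree's production identity
  (`OneFlightGossipEngineAssemblyEntropyProduction.toReal_klDiv_lawAt_localGibbsLaw_sub`:
  `KL(lawAt Φ λ_N t ‖ ψ) − KL(λ_N ‖ ψ₀) = E_{λ_N}[log ρ_{ψ₀} − log ρ_ψ ∘ Φ_t]`) is the expectation of a ONE-BODY
  functional of the trajectory endpoints plus a c-number (`integral_congr_ae`). What R1 of the dock still needs is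
  the trajectory-wise fundamental theorem of calculus for `s ↦ Σ_i g_s((Φ_s z)_i)` along `IsHardSphereTrajectory`
  (streaming integral + `collisionSum` of pair jumps).

Only Literature modules are imported. prover-pitem-stmt-AtomisticToContinuum-13735-0.
-/

noncomputable section

namespace Summit.AtomisticToContinuum.HydrodynamicLimit.Theorems.EntropyClockDock

open MeasureTheory Filter Set
open scoped ENNReal
open Literature.MathematicalPhysics.KineticTheory Literature.Analysis.FluidPDE

/-! ### §1 Logarithms of the local Gibbs densities -/

/-- **Log of the one-body profile**: `log (a(x) M_{1,u(x),θ(x)}(v)) = g(x, v)` for `a(x), θ(x) > 0`. [folklore] -/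
theorem log_localGibbsProfile {a θ : T3 → ℝ} {u : T3 → V3} {x : T3} (ha0 : 0 < a x) (hθ0 : 0 < θ x)
    (v : V3) : Real.log (localGibbsProfile a u θ (x, v)) =
      Real.log (a x) - 3 / 2 * Real.log (2 * Real.pi * θ x) - ‖v - u x‖ ^ 2 / (2 * θ x) := by
  have h2 : 0 < 2 * Real.pi * θ x := by positivity
  have hfin : (Module.finrank ℝ V3 : ℝ) = 3 := by simp
  unfold localGibbsProfile localMaxwellian
  simp only [one_mul, hfin]
  rw [Real.log_mul ha0.ne' (mul_pos (Real.rpow_pos_of_pos h2 _) (Real.exp_pos _)).ne',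
    Real.log_mul (Real.rpow_pos_of_pos h2 _).ne' (Real.exp_pos _).ne', Real.log_rpow h2, Real.log_exp]
  ring

/-- **Log of the canonical local Gibbs density on the hard-sphere domain**: for continuous positive profiles and
`σ ≤ 1/2` (positive partition function), `log ρ_ψ(z) = −log Z_pos(a) + Σ_i g(z_i)`. [folklore] -/
theorem log_canonicalDensity_localGibbsProfile {a θ : T3 → ℝ} {u : T3 → V3} (ha : Continuous a)
    (hθ : Continuous θ) (hu : Continuous u) (ha0 : ∀ x, 0 < a x) (hθ0 : ∀ x, 0 < θ x) {σ : ℝ}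
    (hσ2 : σ ≤ 1 / 2) (N : ℕ) {z : Config (N + 1) (Fin 3) T3}
    (hz : z ∈ hardSphereDomain (Torus.geometry (Fin 3)) (N + 1) (hsDiameter σ N)) :
    Real.log (canonicalDensity (Torus.geometry (Fin 3)) (hsDiameter σ N) (N + 1) (localGibbsProfile a u θ) z) =
      -Real.log (posPartition a (hsDiameter σ N) (N + 1)) +
        ∑ i, (Real.log (a (z i).1) - 3 / 2 * Real.log (2 * Real.pi * θ (z i).1) - ‖(z i).2 - u (z i).1‖ ^ 2 / (2 * θ (z i).1)) := by
  have hZ := posPartition_pos ha ha0 hσ2 N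
  have hpos : ∀ i, 0 < localGibbsProfile a u θ (z i) := fun i =>
    mul_pos (ha0 _) (localMaxwellian_pos one_pos (hθ0 _) _ _)
  have hprod : 0 < ∏ i, localGibbsProfile a u θ (z i) := Finset.prod_pos fun i _ => hpos i
  unfold canonicalDensity
  rw [Set.indicator_of_mem hz, canonicalPartition_eq_posPartition ha hθ hu (fun x => (ha0 x).le) hθ0, tensorPow,
    Real.log_mul (inv_pos.2 hZ).ne' hprod.ne', Real.log_inv,
    Real.log_prod (s := Finset.univ) (f := fun i => localGibbsProfile a u θ (z i)) fun i _ => (hpos i).ne']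
  congr 1
  exact Finset.sum_congr rfl fun i _ => log_localGibbsProfile (ha0 _) (hθ0 _) _

/-! ### §2 The log-ratio along the flow is a one-body functional, almost surely -/

/-- **THE ENTROPY-PRODUCTION INTEGRAND IS A ONE-BODY FUNCTIONAL OF THE TRAJECTORY ENDPOINTS (a.s.).** For the
hard-sphere system on `𝕋³` at `σ ≤ 1/2`, `λ_N = localGibbsLaw σ a₀ u₀ θ₀ N Φ`-almost every initial datum `z` lies in
the hard-sphere domain together with `Φ_t z` (the law is Liouville-absolutely continuous, the good set is conull,
invariant and inside the domain), hence for two local Gibbs references with continuous positive profiles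
`ψ₀ = (b₀, w₀, ϑ₀)`, `ψ = (b, w, ϑ)`:
`log ρ_{ψ₀}(z) − log ρ_ψ(Φ_t z) = [Σ_i g₀(z_i) − Σ_i g((Φ_t z)_i)] + (log Z_pos(b) − log Z_pos(b₀))`.
[cite: Yau1991, §2] -/
theorem ae_logRatio_eq_oneBody {σ : ℝ} (hσ2 : σ ≤ 1 / 2) (a₀ θ₀ : T3 → ℝ) (u₀ : T3 → V3)
    {b₀ ϑ₀ b ϑ : T3 → ℝ} {w₀ w : T3 → V3} (hb₀ : Continuous b₀) (hϑ₀ : Continuous ϑ₀) (hw₀ : Continuous w₀)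
    (hb₀0 : ∀ x, 0 < b₀ x) (hϑ₀0 : ∀ x, 0 < ϑ₀ x) (hb : Continuous b) (hϑ : Continuous ϑ) (hw : Continuous w)
    (hb0 : ∀ x, 0 < b x) (hϑ0 : ∀ x, 0 < ϑ x) (N : ℕ)
    (Φ : HardSphereFlow (Torus.geometry (Fin 3)) (hsDiameter σ N) (N + 1)) (t : ℝ) :
    ∀ᵐ z ∂(localGibbsLaw σ a₀ u₀ θ₀ N Φ),
      Real.log (canonicalDensity (Torus.geometry (Fin 3)) (hsDiameter σ N) (N + 1) (localGibbsProfile b₀ w₀ ϑ₀) z) -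
        Real.log (canonicalDensity (Torus.geometry (Fin 3)) (hsDiameter σ N) (N + 1) (localGibbsProfile b w ϑ)
          (Φ.flow t z)) =
      ((∑ i, (Real.log (b₀ (z i).1) - 3 / 2 * Real.log (2 * Real.pi * ϑ₀ (z i).1) - ‖(z i).2 - w₀ (z i).1‖ ^ 2 / (2 * ϑ₀ (z i).1))) -
          ∑ i, (Real.log (b (Φ.flow t z i).1) - 3 / 2 * Real.log (2 * Real.pi * ϑ (Φ.flow t z i).1) - ‖(Φ.flow t z i).2 - w (Φ.flow t z i).1‖ ^ 2 / (2 * ϑ (Φ.flow t z i).1))) +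
        (Real.log (posPartition b (hsDiameter σ N) (N + 1)) - Real.log (posPartition b₀ (hsDiameter σ N) (N + 1))) := by
  have hac : localGibbsLaw σ a₀ u₀ θ₀ N Φ ≪ liouville (Torus.geometry (Fin 3)) (N + 1) (hsDiameter σ N) := by
    rw [localGibbsLaw, particleLaw_eq]; exact withDensity_absolutelyContinuous _ _
  filter_upwards [hac.ae_le Φ.ae_mem_good] with z hz
  rw [log_canonicalDensity_localGibbsProfile hb₀ hϑ₀ hw₀ hb₀0 hϑ₀0 hσ2 N (Φ.good_subset hz),
    log_canonicalDensity_localGibbsProfile hb hϑ hw hb0 hϑ0 hσ2 N (Φ.good_subset (Φ.mapsTo_good t hz))]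
  ring

end Summit.AtomisticToContinuum.HydrodynamicLimit.Theorems.EntropyClockDock

end
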